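import Summits.AnomalousDissipation.AnomalousDissipation.Theorems.UniformResolution.Negative.ResolutionCriterion
import Summits.AnomalousDissipation.AnomalousDissipation.Theorems.UniformResolution.Negative.Shape
import Summits.AnomalousDissipation.AnomalousDissipation.Theorems.MomentLadder.Negative.Clauses

/-!
# `MomentParity.UniformResolution` (stmt-AnomalousDissipation-14330), line `Sketch`:
# the uniform-integrability currency is NECESSARY

Support file of the line lead (prover-line-stmt-AnomalousDissipation-14330-0) for the picked line `Sketch`
(`Cruxes/UniformResolution/Lines/Sketch.lean`), whose only conjectural stub `stub_loudUI` asks for loud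
invariant level-`N` families with UNIFORMLY INTEGRABLE ENSTROPHY. This file certifies the converse direction
of the line's equivalence "resolution ⟺ uniform integrability" (card `enstrophy-ui-localized-tail-budget`,
corollary `ResolutionIffUI`, direction ⇒), so that the stub is the crux undressed rather than a strengthening:

* `uniformlyIntegrableEnstrophy_of_isResolved` — a family of laws on `H` supported in ONE ball `‖u‖ ≤ R`,
  resolved by ONE schedule `κ` (the crux's clause `IsResolved κ μ`) and with mean enstrophy `≤ M < ∞` has
  uniformly integrable enstrophy: on the ball `‖∇P_{κ n} u‖² ≤ 4π² κ(n)² R²` (Bernstein), so on the burst event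
  `{‖∇u‖² > L}` the enstrophy is at most `4π²κ(n)²R² · μ{‖∇u‖² > L} + tail_{κ n}`, Markov bounds the first term by
  `4π²κ(n)²R² M / L` and the resolution clause bounds the mean tail by `1/(n+1)`.
* `uniformlyIntegrableEnstrophy_of_resolved_polyStationary` — hence every family of RESOLVED level laws in a
  ball that are polynomially stationary at some order `d ≥ 3` with mean energy `≤ E` (the members of the crux's
  conclusion body) is uniformly integrable: the energy row gives `ν ∫‖∇u‖² ≤ ‖f‖₂ √E` uniformly.
* `IsResolvedLoudFamilyAt.uniformlyIntegrable` — the conclusion body of the crux at one viscosity, restated with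
  its (order `≥ 3`) witnesses collected in ONE uniformly integrable family.
-/

noncomputable section

-- `Summit.<Summit>.<Problem>` duplicate namespace is the tree's mandated layout for single-conjunct summits.
set_option linter.dupNamespace false

namespace Summit.AnomalousDissipation.AnomalousDissipation.Theorems.MomentParityUniformResolution

open MeasureTheory Filter Topology
open scoped ENNReal
open Literature.Analysis.FunctionSpaces Literature.Analysis.FluidPDE
open Summit.AnomalousDissipation.AnomalousDissipation.Theses.MomentParity
open Summit.AnomalousDissipation.AnomalousDissipation.Theorems.QuarticGate.Negative
open Summit.AnomalousDissipation.AnomalousDissipation.Theorems.UniformResolution.Negative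

open Summit.AnomalousDissipation.AnomalousDissipation.Theorems.CubicParityLoud.Negative (L2T3)

/-- **Bernstein on the ball**: for `‖u‖ ≤ R`, `‖∇P_m u‖² ≤ 4π² m² R²` (in `ℝ≥0∞`). [folklore] -/
theorem eGradNormSq_fourierTruncate_le_of_norm_le (m : ℕ) {u : Torus.energySpace (Fin 3)} {R : ℝ}
    (hu : ‖u‖ ≤ R) :
    Torus.eGradNormSq (Torus.fourierTruncate m ((u.1 : L2T3) : UnitAddTorus (Fin 3) → EuclideanSpace ℝ (Fin 3))) ≤
      ENNReal.ofReal (4 * Real.pi ^ 2 * (m : ℝ) ^ 2) * ENNReal.ofReal R ^ 2 := by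
  have hR : 0 ≤ R := (norm_nonneg u).trans hu
  refine (MomentLadder.Negative.eGradNormSq_fourierTruncate_le_sq_mul m (u.1 : L2T3)).trans ?_
  gcongr
  rw [← ofReal_norm]
  exact ENNReal.ofReal_le_ofReal hu

/-- **RESOLUTION ⇒ UNIFORM INTEGRABILITY.** A family of laws on `H` supported in one ball `‖u‖ ≤ R`, resolved by
one schedule `κ` (`IsResolved κ μ`, the crux's clause) and with mean enstrophy at most `M < ∞`, has uniformly
integrable enstrophy (`UniformlyIntegrableEnstrophy`). For `η > 0`: pick `n` with `1/(n+1) ≤ η/2`, put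
`K = 4π²κ(n)²R²`, pick a level `L ∈ ℕ` with `K M < L · η/2`; on `{‖∇u‖² > L}` one has
`‖∇u‖² = ‖∇P_{κ n}u‖² + tail ≤ K + tail`, Markov gives `K μ{‖∇u‖² > L} ≤ K M / L ≤ η/2`, and the resolution
clause gives `∫ tail ≤ 1/(n+1) ≤ η/2`. [folklore] -/
theorem uniformlyIntegrableEnstrophy_of_isResolved
    {𝓕 : Set (Measure (Torus.energySpace (Fin 3)))} {R : ℝ} {κ : ℕ → ℕ} {M : ℝ≥0∞} (hM : M ≠ ⊤)
    (h : ∀ μ ∈ 𝓕, (∀ᵐ u ∂μ, ‖u‖ ≤ R) ∧ IsResolved κ μ ∧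
      ∫⁻ u, Torus.eGradNormSq ((u.1 : L2T3) : UnitAddTorus (Fin 3) → EuclideanSpace ℝ (Fin 3)) ∂μ ≤ M) :
    UniformlyIntegrableEnstrophy 𝓕 := by
  intro η hη
  -- abbreviations
  let eG : Torus.energySpace (Fin 3) → ℝ≥0∞ := fun u =>
    Torus.eGradNormSq ((u.1 : L2T3) : UnitAddTorus (Fin 3) → EuclideanSpace ℝ (Fin 3))
  let lo : ℕ → Torus.energySpace (Fin 3) → ℝ≥0∞ := fun m u =>
    Torus.eGradNormSq (Torus.fourierTruncate m ((u.1 : L2T3) : UnitAddTorus (Fin 3) → EuclideanSpace ℝ (Fin 3)))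
  let tl : ℕ → Torus.energySpace (Fin 3) → ℝ≥0∞ := fun m u =>
    Torus.tailGradNormSq m ((u.1 : L2T3) : UnitAddTorus (Fin 3) → EuclideanSpace ℝ (Fin 3))
  have heG : Measurable eG := Torus.measurable_eGradNormSq_coe
  have htl : ∀ m, Measurable (tl m) := measurable_tailGradNormSq_coe
  have hsplit : ∀ (m : ℕ) (u : Torus.energySpace (Fin 3)), eG u = lo m u + tl m u := fun m u =>
    eGradNormSq_eq_fourierTruncate_add_tail ((Lp.memLp (u.1 : L2T3)).integrable one_le_two) m
  -- the case `η = ⊤` is trivial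
  by_cases hηtop : η = ⊤
  · exact ⟨0, ENNReal.zero_ne_top, fun μ _ => hηtop ▸ le_top⟩
  -- half the budget
  set η2 : ℝ≥0∞ := η / 2 with hη2
  have hη20 : η2 ≠ 0 := (ENNReal.div_pos hη.ne' ENNReal.ofNat_ne_top).ne'
  have hη2top : η2 ≠ ⊤ := ENNReal.div_ne_top hηtop two_ne_zero
  -- the resolution index
  obtain ⟨n, hn⟩ := ENNReal.exists_inv_nat_lt hη20
  have hn' : ((n : ℝ≥0∞) + 1)⁻¹ ≤ η2 := (ENNReal.inv_le_inv.2 le_self_add).trans hn.le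
  -- the Bernstein ceiling of the resolved part on the ball
  set K : ℝ≥0∞ := ENNReal.ofReal (4 * Real.pi ^ 2 * ((κ n : ℕ) : ℝ) ^ 2) * ENNReal.ofReal R ^ 2 with hK_def
  have hKtop : K ≠ ⊤ := ENNReal.mul_ne_top ENNReal.ofReal_ne_top (ENNReal.pow_ne_top ENNReal.ofReal_ne_top)
  -- the burst level
  have hKM : K * M / η2 ≠ ⊤ := ENNReal.div_ne_top (ENNReal.mul_ne_top hKtop hM) hη20
  obtain ⟨L, hL⟩ := ENNReal.exists_nat_gt hKM
  have hL0 : (L : ℝ≥0∞) ≠ 0 := by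
    intro h0
    rw [h0] at hL
    exact not_lt_zero hL
  have hKML : K * M ≤ (L : ℝ≥0∞) * η2 := by
    have := (ENNReal.div_lt_iff (Or.inl hη20) (Or.inl hη2top)).1 hL
    exact this.le
  refine ⟨L, ENNReal.natCast_ne_top L, fun μ hμ => ?_⟩
  obtain ⟨hball, hres, hmean⟩ := h μ hμ
  set S : Set (Torus.energySpace (Fin 3)) := {u | (L : ℝ≥0∞) < eG u} with hS_def
  have hS : MeasurableSet S := measurableSet_lt measurable_const heG
  -- (1) Markov: K μ(S) ≤ η/2
  have hMarkov : K * μ S ≤ η2 := by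
    have h1 : (L : ℝ≥0∞) * μ S ≤ M := by
      calc (L : ℝ≥0∞) * μ S ≤ (L : ℝ≥0∞) * μ {u | (L : ℝ≥0∞) ≤ eG u} := by
            gcongr
            intro u hu
            exact le_of_lt (show (L : ℝ≥0∞) < eG u from hu)
        _ ≤ ∫⁻ u, eG u ∂μ := mul_meas_ge_le_lintegral₀ heG.aemeasurable _
        _ ≤ M := hmean
    have h2 : (L : ℝ≥0∞) * (K * μ S) ≤ (L : ℝ≥0∞) * η2 := by
      calc (L : ℝ≥0∞) * (K * μ S) = K * ((L : ℝ≥0∞) * μ S) := mul_left_comm _ _ _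
        _ ≤ K * M := by gcongr
        _ ≤ (L : ℝ≥0∞) * η2 := hKML
    exact (ENNReal.mul_le_mul_iff_right hL0 (ENNReal.natCast_ne_top L)).1 h2
  -- (2) the resolution clause: ∫ tail ≤ 1/(n+1) ≤ η/2
  have hTail : ∫⁻ u, tl (κ n) u ∂μ ≤ η2 := by
    have hlo_le' : ∫⁻ u, lo (κ n) u ∂μ ≤ ∫⁻ u, eG u ∂μ := by
      refine lintegral_mono fun u => ?_
      exact Literature.Analysis.FluidPDE.Torus.eGradNormSq_fourierTruncate_le
        ((Lp.memLp (u.1 : L2T3)).integrable one_le_two) (κ n)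
    have hlo_le : ∫⁻ u, lo (κ n) u ∂μ ≤ M := hlo_le'.trans hmean
    have hlotop : ∫⁻ u, lo (κ n) u ∂μ ≠ ⊤ := ne_top_of_le_ne_top hM hlo_le
    have hr : ∫⁻ u, eG u ∂μ ≤ (∫⁻ u, lo (κ n) u ∂μ) + ((n : ℝ≥0∞) + 1)⁻¹ := hres n
    have e : ∫⁻ u, eG u ∂μ = (∫⁻ u, lo (κ n) u ∂μ) + ∫⁻ u, tl (κ n) u ∂μ := by
      rw [← lintegral_add_right _ (htl _)]
      exact lintegral_congr fun u => hsplit _ u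
    rw [e, ENNReal.add_le_add_iff_left hlotop] at hr
    exact hr.trans hn'
  -- (3) pointwise on the ball: Z·1_S ≤ K·1_S + tail
  have hpt : ∀ᵐ u ∂μ, S.indicator eG u ≤ S.indicator (fun _ => K) u + tl (κ n) u := by
    filter_upwards [hball] with u hu
    by_cases huS : u ∈ S
    · rw [Set.indicator_of_mem huS, Set.indicator_of_mem huS, hsplit (κ n) u]
      gcongr
      exact eGradNormSq_fourierTruncate_le_of_norm_le (κ n) hu
    · rw [Set.indicator_of_notMem huS, Set.indicator_of_notMem huS]
      exact zero_le
  -- integrate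
  calc ∫⁻ u in S, eG u ∂μ = ∫⁻ u, S.indicator eG u ∂μ := (lintegral_indicator hS _).symm
    _ ≤ ∫⁻ u, S.indicator (fun _ => K) u + tl (κ n) u ∂μ := lintegral_mono_ae hpt
    _ = K * μ S + ∫⁻ u, tl (κ n) u ∂μ := by
        rw [lintegral_add_right _ (htl _), lintegral_indicator_const hS]
    _ ≤ η2 + η2 := add_le_add hMarkov hTail
    _ = η := ENNReal.add_halves η

/-- Bounded support on a finite measure carried by level-`N` fields gives finite mean enstrophy
(Bernstein ceiling `‖∇u‖² ≤ 4π²N²‖u‖²`). [folklore] -/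
theorem ensembleEnstrophy_ne_top_of_level_of_ball {N : ℕ} {R : ℝ} {μ : Measure (Torus.energySpace (Fin 3))}
    [IsFiniteMeasure μ] (hlev : ∀ᵐ u ∂μ, IsLevel N u) (hball : ∀ᵐ u ∂μ, ‖u‖ ≤ R) :
    Torus.ensembleEnstrophy μ ≠ ⊤ := by
  have h2 : ∫⁻ u, ‖u‖ₑ ^ 2 ∂μ ≤ ∫⁻ _, ENNReal.ofReal R ^ 2 ∂μ := by
    refine lintegral_mono_ae (hball.mono fun u hu => ?_)
    have hR : 0 ≤ R := (norm_nonneg u).trans hu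
    rw [← ofReal_norm]
    gcongr
  have h3 : ∫⁻ u, ‖u‖ₑ ^ 2 ∂μ ≠ ⊤ := by
    refine ne_top_of_le_ne_top ?_ h2
    rw [lintegral_const]
    exact ENNReal.mul_ne_top (ENNReal.pow_ne_top ENNReal.ofReal_ne_top) (measure_ne_top _ _)
  exact ne_top_of_le_ne_top (ENNReal.mul_ne_top ENNReal.ofReal_ne_top h3) (ensembleEnstrophy_le_of_level hlev)

/-- **Resolved order-`≥ 3` level laws in a ball with bounded mean energy are uniformly integrable.** The members
of the conclusion body of `UniformResolution` at one viscosity `ν > 0` — probability laws carried by level-`N`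
fields (any `N`) in one ball `‖u‖ ≤ R`, resolved by one schedule `κ`, polynomially stationary at some order
`d ≥ 3`, with mean energy `≤ E` — form a family with uniformly integrable enstrophy: the energy row
(`ensembleDissipation_le_of_polyStationary`) gives the `N`-uniform mean bound `ν ∫‖∇u‖² ≤ ‖f‖₂ √E`, and
`uniformlyIntegrableEnstrophy_of_isResolved` applies. [folklore] -/
theorem uniformlyIntegrableEnstrophy_of_resolved_polyStationary
    (f : UnitAddTorus (Fin 3) → EuclideanSpace ℝ (Fin 3)) (hf : MemLp f 2 volume) {ν : ℝ} (hν : 0 < ν)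
    (R E : ℝ) (κ : ℕ → ℕ) :
    UniformlyIntegrableEnstrophy {μ | IsProbabilityMeasure μ ∧ ∃ N d : ℕ, 3 ≤ d ∧ (∀ᵐ u ∂μ, IsLevel N u) ∧
      (∀ᵐ u ∂μ, ‖u‖ ≤ R) ∧ IsResolved κ μ ∧ IsPolyStationary ν f N d μ ∧ Torus.ensembleEnergy μ ≤ E} := by
  set M : ℝ≥0∞ := ENNReal.ofReal (Real.sqrt (∫ x, ‖f x‖ ^ 2) * Real.sqrt E / ν) with hM_def
  refine uniformlyIntegrableEnstrophy_of_isResolved (R := R) (κ := κ) (M := M) ENNReal.ofReal_ne_top ?_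
  rintro μ ⟨hp, N, d, hd, hlev, hball, hres, hst, hE⟩
  refine ⟨hball, hres, ?_⟩
  haveI := hp
  have htop : Torus.ensembleEnstrophy μ ≠ ⊤ := ensembleEnstrophy_ne_top_of_level_of_ball hlev hball
  have h2 : Integrable (fun u : Torus.energySpace (Fin 3) => ‖u‖ ^ 2) μ := integrable_norm_sq_of_ae_norm_le hball
  have hD := ensembleDissipation_le_of_polyStationary f hf hlev h2 hd hst
  have hE0 : 0 ≤ Torus.ensembleEnergy μ := integral_nonneg fun u => by positivity
  have hreal : (Torus.ensembleEnstrophy μ).toReal ≤ Real.sqrt (∫ x, ‖f x‖ ^ 2) * Real.sqrt E / ν := by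
    rw [le_div_iff₀ hν, mul_comm]
    calc ν * (Torus.ensembleEnstrophy μ).toReal = Torus.ensembleDissipation ν μ := rfl
      _ ≤ Real.sqrt (∫ x, ‖f x‖ ^ 2) * Real.sqrt (Torus.ensembleEnergy μ) := hD
      _ ≤ Real.sqrt (∫ x, ‖f x‖ ^ 2) * Real.sqrt E := by gcongr
  calc ∫⁻ u, Torus.eGradNormSq ((u.1 : L2T3) : UnitAddTorus (Fin 3) → EuclideanSpace ℝ (Fin 3)) ∂μ
      = Torus.ensembleEnstrophy μ := rfl
    _ = ENNReal.ofReal (Torus.ensembleEnstrophy μ).toReal := (ENNReal.ofReal_toReal htop).symm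
    _ ≤ M := ENNReal.ofReal_le_ofReal hreal

/-- **The conclusion body of the crux is a UNIFORMLY INTEGRABLE loud family.** At one viscosity `ν > 0`,
`IsResolvedLoudFamilyAt f ν E ε` (the conclusion of `UniformResolution` at `ν`) yields one ball, one schedule
and ONE family of laws with uniformly integrable enstrophy containing, for infinitely many levels `N` and every
order `d ≥ 3`, a loud resolved `d`-stationary level-`N` law with budgets `(E, ε)`. So uniform integrability of
the enstrophy — the currency of the line's only conjectural stub `stub_loudUI` — is NECESSARY for the crux, not
merely sufficient. [folklore] -/
theorem IsResolvedLoudFamilyAt.uniformlyIntegrable {f : UnitAddTorus (Fin 3) → EuclideanSpace ℝ (Fin 3)}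
    (hf : MemLp f 2 volume) {ν E ε : ℝ} (hν : 0 < ν) (h : IsResolvedLoudFamilyAt f ν E ε) :
    ∃ (R : ℝ) (κ : ℕ → ℕ) (𝓕 : Set (Measure (Torus.energySpace (Fin 3)))), UniformlyIntegrableEnstrophy 𝓕 ∧
      ∃ᶠ N in atTop, ∀ d : ℕ, 3 ≤ d → ∃ μ ∈ 𝓕, IsProbabilityMeasure μ ∧ (∀ᵐ u ∂μ, IsLevel N u) ∧
        (∀ᵐ u ∂μ, ‖u‖ ≤ R) ∧ IsResolved κ μ ∧ IsPolyStationary ν f N d μ ∧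
        Torus.ensembleEnergy μ ≤ E ∧ ε ≤ Torus.ensembleDissipation ν μ := by
  obtain ⟨R, κ, hfreq⟩ := h
  refine ⟨R, κ, _, uniformlyIntegrableEnstrophy_of_resolved_polyStationary f hf hν R E κ, hfreq.mono ?_⟩
  intro N hN d hd
  obtain ⟨μ, hp, hlev, hball, hres, hst, hE, hD⟩ := hN d
  exact ⟨μ, ⟨hp, N, d, hd, hlev, hball, hres, hst, hE⟩, hp, hlev, hball, hres, hst, hE, hD⟩

/-- **Registered form (sub-goal `resolved_implies_uniformlyIntegrable` of stmt-AnomalousDissipation-14330).**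
The conclusion body of `UniformResolution` at one viscosity `ν > 0` (for an `L²` force) is witnessed inside ONE
family of laws with uniformly integrable enstrophy: uniform integrability of the enstrophy — the currency of the
line's conjectural stub `stub_loudUI` — is necessary for the crux. [folklore] -/
theorem resolved_implies_uniformlyIntegrable : ∀ (f : UnitAddTorus (Fin 3) → EuclideanSpace ℝ (Fin 3)), MeasureTheory.MemLp f 2 MeasureTheory.volume → ∀ (ν E ε : ℝ), 0 < ν → Summit.AnomalousDissipation.AnomalousDissipation.Theorems.UniformResolution.Negative.IsResolvedLoudFamilyAt f ν E ε → ∃ (R : ℝ) (κ : ℕ → ℕ) (𝓕 : Set (MeasureTheory.Measure (Literature.Analysis.FunctionSpaces.Torus.energySpace (Fin 3)))), Summit.AnomalousDissipation.AnomalousDissipation.Theorems.UniformResolution.Negative.UniformlyIntegrableEnstrophy 𝓕 ∧ ∃ᶠ N in Filter.atTop, ∀ d : ℕ, 3 ≤ d → ∃ μ ∈ 𝓕, MeasureTheory.IsProbabilityMeasure μ ∧ (∀ᵐ u ∂μ, Summit.AnomalousDissipation.AnomalousDissipation.Theorems.QuarticGate.Negative.IsLevel N u) ∧ (∀ᵐ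 u ∂μ, ‖u‖ ≤ R) ∧ Summit.AnomalousDissipation.AnomalousDissipation.Theorems.UniformResolution.Negative.IsResolved κ μ ∧ Summit.AnomalousDissipation.AnomalousDissipation.Theorems.QuarticGate.Negative.IsPolyStationary ν f N d μ ∧ Literature.Analysis.FluidPDE.Torus.ensembleEnergy μ ≤ E ∧ ε ≤ Literature.Analysis.FluidPDE.Torus.ensembleDissipation ν μ :=
  fun _ hf _ _ _ hν h => IsResolvedLoudFamilyAt.uniformlyIntegrable hf hν h

end Summit.AnomalousDissipation.AnomalousDissipation.Theorems.MomentParityUniformResolution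

end
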